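import Literature.Barriers.CriticalPhenomena.FKParafermionicHalfCauchyRiemann
import Summits.CriticalPhenomena.CardyFormulaZ2.Theorems.EdgeCoherence.Negative.HalfCRHarmonics

/-!
# `EdgeCoherence` (stmt-CriticalPhenomena-11385): the CONJUGATE-AND-STAGGER symmetry of the known half of
# discrete Cauchy–Riemann — why no vertex identity can separate the alternating alias from the signal

Crux strategist `planner-cstrat-stmt-CriticalPhenomena-11385-s2-0` (STRATEGY-CENSUS (s2) §Transfer 2 / §Negation 1), 2026-08-17;
landed verbatim (docstrings + the registered summary theorem `conjStagger_barrier` added) by the line lead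
`prover-line-stmt-CriticalPhenomena-11385-c2-0` as a Negative/ helper `--supports stmt-CriticalPhenomena-11385`
(tree copy of the source: `Cruxes/EdgeCoherence/ConjStaggerSymmetry.lean`).
Purely algebraic (any function `F` on corners = medial edges; no probability).

For a corner `(v, f)` of class `c` (offset `f − v ∈ {0, −e₀, −e₀−e₁, −e₁}` ↔ `c = 0, 1, 2, 3`) put
`stag (v,f) = (−1)^c` (the parity of the offset) and `conjStag F (v,f) = (−1)^c · conj (F (v,f))`.

* `halfCRRelationAt_conjStag_iff`: at EVERY medial vertex, `conjStag F` satisfies the printed vertex relation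
  `F(NW) − F(SE) = i (F(NE) − F(SW))` (`HalfCRRelationAt Complex.I`, Duminil-Copin–Smirnov 2012 Prop. 8.6 /
  Duminil-Copin 2012 Prop. 4 at `q = 1`) iff `F` does — because the two Kirchhoff pairs {NW, SE}, {NE, SW} consist of
  corners of equal class parity, opposite between the pairs (`stag_medialCornersAt`), and `conj i = −i`.
* `H0_conjStag`, `H1_conjStag`, `H2_conjStag`, `H3_conjStag`: on the `ℤ₄`-harmonics of the four corner values at a
  site (`HalfCRHarmonics.H0 … H3`) the symmetry reads `H₀ ↦ conj H₂`, `H₂ ↦ conj H₀`, `H₁ ↦ conj H₁`, `H₃ ↦ conj H₃`: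
  it EXCHANGES the spin-`1/3` signal with the alternating (spin-`5/3`) alias.  (These are the two roots `σ = 1/3, 5/3`
  of the spin equation `2 sin(πσ/2) = √q` at `q = 1`.)
* `halfCR_add_conjStag`: consequently, for every solution `F` of all the vertex relations and every `λ : ℂ`,
  `F + λ • conjStag F` is again a solution, with alternating mode `H₂ + λ conj H₀` (`H2_add_conjStag`).

Reading for the crux: `AlternatingModeNull` (`H₂ = o(δ^{1/3})`, the piece of `EdgeCoherence` the route consumes) is
independent of the vertex relations together with any information invariant under conjugate-and-stagger (interior
envelopes, classwise equicontinuity): the catalogued barrier `FKParafermionicHalfCauchyRiemann` read on the alternating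
mode.  A proof must use the LAW of the interface winding (the `ℤ₁₂` mode `5` versus the signal mode `−1`).

References: H. Duminil-Copin, S. Smirnov, *Conformal invariance of lattice models*, Clay Math. Proc. 15 (2012), §8,
Prop. 8.6; H. Duminil-Copin, *Parafermionic observables and their applications*, arXiv:1208.3787, Prop. 4;
tree `Theorems/EdgeCoherence/Negative/HalfCRHarmonics.lean` (harmonic form of the relation).
-/

noncomputable section

open Literature.Probability.LatticeModels Literature.Barriers.CriticalPhenomena
open scoped ComplexConjugate
open Summit.CriticalPhenomena.CardyFormulaZ2.Theorems.EdgeCoherence.Negative.HalfCRHarmonics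
  (E0 E1 E2 E3 H0 H1 H2 H3)

namespace Summit.CriticalPhenomena.CardyFormulaZ2.Cruxes.EdgeCoherence.ConjStagger

/-- The class parity of a corner `(v, f)`: the parity of `(f − v)₀ + (f − v)₁`. [folklore] -/
def offsetSum (p : Site 2 × Site 2) : ℤ := (p.2 0 - p.1 0) + (p.2 1 - p.1 1)

/-- The STAGGER sign `(−1)^class` of a corner. [folklore] -/
def stag (p : Site 2 × Site 2) : ℂ := if Even (offsetSum p) then 1 else -1

/-- CONJUGATE-AND-STAGGER of a corner field: `F ↦ (−1)^class · conj F`. [folklore] -/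
def conjStag (F : Site 2 × Site 2 → ℂ) (p : Site 2 × Site 2) : ℂ := stag p * conj (F p)

/-- Even class parity: stagger sign `1`. -/
theorem stag_of_even {p : Site 2 × Site 2} (h : Even (offsetSum p)) : stag p = 1 := by
  simp [stag, h]

/-- Odd class parity: stagger sign `−1`. -/
theorem stag_of_not_even {p : Site 2 × Site 2} (h : ¬ Even (offsetSum p)) : stag p = -1 := by
  simp [stag, h]

/-- The stagger sign squares to `1`. -/
theorem stag_mul_stag (p : Site 2 × Site 2) : stag p * stag p = 1 := by
  unfold stag; split_ifs <;> norm_num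

/-- The stagger sign is nonzero. -/
theorem stag_ne_zero (p : Site 2 × Site 2) : stag p ≠ 0 := by
  unfold stag; split_ifs <;> norm_num

/-! ## The class parities of the barrier's corner table -/

/-- `e₀ 0 = 1`. -/
private theorem e0_apply_zero : (Pi.single 0 1 : Site 2) 0 = 1 := by simp
/-- `e₀ 1 = 0`. -/
private theorem e0_apply_one : (Pi.single 0 1 : Site 2) 1 = 0 := by simp
/-- `e₁ 0 = 0`. -/
private theorem e1_apply_zero : (Pi.single 1 1 : Site 2) 0 = 0 := by simp
/-- `e₁ 1 = 1`. -/
private theorem e1_apply_one : (Pi.single 1 1 : Site 2) 1 = 1 := by simp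

/-- Offset sums of the four corners of the barrier's corner table at a medial vertex. -/
theorem offsetSum_medialCornersAt (x : Site 2) :
    offsetSum (medialCornersAt x 0 0) = 0 ∧ offsetSum (medialCornersAt x 0 1) = -1 ∧
    offsetSum (medialCornersAt x 0 2) = -2 ∧ offsetSum (medialCornersAt x 0 3) = -1 ∧
    offsetSum (medialCornersAt x 1 0) = -2 ∧ offsetSum (medialCornersAt x 1 1) = -1 ∧
    offsetSum (medialCornersAt x 1 2) = 0 ∧ offsetSum (medialCornersAt x 1 3) = -1 := by
  simp only [offsetSum, medialCornersAt, Matrix.cons_val_zero, Matrix.cons_val_one, Matrix.head_cons,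
    Matrix.cons_val_two, Matrix.tail_cons, Matrix.cons_val_three, Pi.add_apply, Pi.sub_apply,
    e0_apply_zero, e0_apply_one, e1_apply_zero, e1_apply_one]
  refine ⟨?_, ?_, ?_, ?_, ?_, ?_, ?_, ?_⟩ <;> ring

/-- **Class parities at a medial vertex**: the Kirchhoff pair {0, 2} = {NW, SE} has EQUAL stagger sign `s`, the pair
{1, 3} = {NE, SW} the OPPOSITE sign `−s` (horizontal: `s = 1`; vertical: `s = 1` as well, with corners 0,2 even). [folklore] -/
theorem stag_medialCornersAt (x : Site 2) (i : Fin 2) :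
    stag (medialCornersAt x i 0) = 1 ∧ stag (medialCornersAt x i 1) = -1 ∧
    stag (medialCornersAt x i 2) = 1 ∧ stag (medialCornersAt x i 3) = -1 := by
  obtain ⟨h00, h01, h02, h03, h10, h11, h12, h13⟩ := offsetSum_medialCornersAt x
  fin_cases i
  · refine ⟨stag_of_even ?_, stag_of_not_even ?_, stag_of_even ?_, stag_of_not_even ?_⟩
    · simp only [Fin.zero_eta] at *; rw [h00]; decide
    · simp only [Fin.zero_eta] at *; rw [h01]; decide
    · simp only [Fin.zero_eta] at *; rw [h02]; decide
    · simp only [Fin.zero_eta] at *; rw [h03]; decide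
  · refine ⟨stag_of_even ?_, stag_of_not_even ?_, stag_of_even ?_, stag_of_not_even ?_⟩
    · simp only [Fin.mk_one] at *; rw [h10]; decide
    · simp only [Fin.mk_one] at *; rw [h11]; decide
    · simp only [Fin.mk_one] at *; rw [h12]; decide
    · simp only [Fin.mk_one] at *; rw [h13]; decide

/-! ## The symmetry of the vertex relation -/

/-- **Conjugate-and-stagger preserves the printed vertex relation** (chirality `i`) at every medial vertex.
[cite: DuminilCopinSmirnov2012Lattice, Proposition 8.6] -/
theorem halfCRRelationAt_conjStag_iff (F : Site 2 × Site 2 → ℂ) (x : Site 2) (i : Fin 2) :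
    HalfCRRelationAt Complex.I (conjStag F) (x, i) ↔ HalfCRRelationAt Complex.I F (x, i) := by
  obtain ⟨s0, s1, s2, s3⟩ := stag_medialCornersAt x i
  simp only [HalfCRRelationAt, conjStag, s0, s1, s2, s3, one_mul, neg_mul, sub_neg_eq_add]
  constructor
  · intro h
    -- h : conj F0 - conj F2 = I * (-conj F1 + conj F3); conjugate it back
    have h' := congrArg conj h
    simp only [map_sub, map_add, map_mul, map_neg, Complex.conj_conj, Complex.conj_I] at h'
    linear_combination h'
  · intro h
    have h' := congrArg conj h
    simp only [map_sub, map_mul, Complex.conj_I] at h'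
    linear_combination h'

/-- The symmetry on the WHOLE system of vertex relations. [cite: DuminilCopinSmirnov2012Lattice, Proposition 8.6] -/
theorem forall_halfCRRelationAt_conjStag_iff (F : Site 2 × Site 2 → ℂ) :
    (∀ p : Site 2 × Fin 2, HalfCRRelationAt Complex.I (conjStag F) p) ↔
      ∀ p : Site 2 × Fin 2, HalfCRRelationAt Complex.I F p :=
  ⟨fun h p => (halfCRRelationAt_conjStag_iff F p.1 p.2).1 (h p),
   fun h p => (halfCRRelationAt_conjStag_iff F p.1 p.2).2 (h p)⟩

/-! ## The symmetry on the `ℤ₄`-harmonics: signal ↔ alternating alias -/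

/-- Class `0` has offset sum `0`. -/
private theorem offsetSum_class0 (v : Site 2) : offsetSum (v, v) = 0 := by simp [offsetSum]
/-- Class `1` has offset sum `−1`. -/
private theorem offsetSum_class1 (v : Site 2) : offsetSum (v, v - Pi.single 0 1) = -1 := by
  simp [offsetSum]
/-- Class `2` has offset sum `−2`. -/
private theorem offsetSum_class2 (v : Site 2) : offsetSum (v, v - Pi.single 0 1 - Pi.single 1 1) = -2 := by
  simp [offsetSum]
/-- Class `3` has offset sum `−1`. -/
private theorem offsetSum_class3 (v : Site 2) : offsetSum (v, v - Pi.single 1 1) = -1 := by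
  simp [offsetSum]

/-- Class `0` stagger sign `1`. -/
theorem stag_class0 (v : Site 2) : stag (v, v) = 1 := stag_of_even (by rw [offsetSum_class0]; decide)
/-- Class `1` stagger sign `−1`. -/
theorem stag_class1 (v : Site 2) : stag (v, v - Pi.single 0 1) = -1 :=
  stag_of_not_even (by rw [offsetSum_class1]; decide)
/-- Class `2` stagger sign `1`. -/
theorem stag_class2 (v : Site 2) : stag (v, v - Pi.single 0 1 - Pi.single 1 1) = 1 :=
  stag_of_even (by rw [offsetSum_class2]; decide)
/-- Class `3` stagger sign `−1`. -/
theorem stag_class3 (v : Site 2) : stag (v, v - Pi.single 1 1) = -1 :=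
  stag_of_not_even (by rw [offsetSum_class3]; decide)

/-- `H₀[conjStag F] = conj H₂[F]`: the signal of the transformed field is the conjugate alternating alias. [folklore] -/
theorem H0_conjStag (F : Site 2 × Site 2 → ℂ) (v : Site 2) : H0 (conjStag F) v = conj (H2 F v) := by
  simp only [H0, H2, E0, E1, E2, E3, conjStag, stag_class0, stag_class1, stag_class2, stag_class3, map_sub, map_add]
  ring

/-- `H₂[conjStag F] = conj H₀[F]`. [folklore] -/
theorem H2_conjStag (F : Site 2 × Site 2 → ℂ) (v : Site 2) : H2 (conjStag F) v = conj (H0 F v) := by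
  simp only [H0, H2, E0, E1, E2, E3, conjStag, stag_class0, stag_class1, stag_class2, stag_class3, map_add]
  ring

/-- `H₁[conjStag F] = conj H₁[F]`. [folklore] -/
theorem H1_conjStag (F : Site 2 × Site 2 → ℂ) (v : Site 2) : H1 (conjStag F) v = conj (H1 F v) := by
  simp only [H1, E0, E1, E2, E3, conjStag, stag_class0, stag_class1, stag_class2, stag_class3, map_sub, map_add,
    map_mul, Complex.conj_I]
  ring

/-- `H₃[conjStag F] = conj H₃[F]`. [folklore] -/
theorem H3_conjStag (F : Site 2 × Site 2 → ℂ) (v : Site 2) : H3 (conjStag F) v = conj (H3 F v) := by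
  simp only [H3, E0, E1, E2, E3, conjStag, stag_class0, stag_class1, stag_class2, stag_class3, map_sub, map_add,
    map_mul, Complex.conj_I]
  ring

/-! ## Consequence: fake half-CR solutions with a large alternating mode -/

/-- For every solution `F` of ALL the vertex relations and every `λ`, `F + λ • conjStag F` is again a solution.
[cite: DuminilCopinSmirnov2012Lattice, Proposition 8.6] -/
theorem halfCR_add_conjStag (F : Site 2 × Site 2 → ℂ) (hF : ∀ p : Site 2 × Fin 2, HalfCRRelationAt Complex.I F p)
    (c : ℂ) : ∀ p : Site 2 × Fin 2, HalfCRRelationAt Complex.I (F + c • conjStag F) p := by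
  intro p
  have h1 := hF p
  have h2 := (forall_halfCRRelationAt_conjStag_iff F).2 hF p
  simp only [HalfCRRelationAt, Pi.add_apply, Pi.smul_apply, smul_eq_mul] at h1 h2 ⊢
  linear_combination h1 + c * h2

/-- … and its alternating mode is `H₂[F] + λ · conj H₀[F]`: as large as the signal whenever `λ ≠ 0`. [folklore] -/
theorem H2_add_conjStag (F : Site 2 × Site 2 → ℂ) (c : ℂ) (v : Site 2) :
    H2 (F + c • conjStag F) v = H2 F v + c * conj (H0 F v) := by
  rw [← H2_conjStag]
  simp only [H2, E0, E1, E2, E3, Pi.add_apply, Pi.smul_apply, smul_eq_mul]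
  ring

/-! ## Registered summary (the barrier in one statement) -/

/-- **The conjugate-and-stagger barrier** (registered sub-goal `conjStagger_barrier`): every solution `F` of all the
printed vertex relations generates the one-parameter family `F + λ • conjStag F` of solutions whose alternating mode is
`H₂[F] + λ · conj H₀[F]` — so no argument using only the vertex relations (plus conjugate-and-stagger-invariant
information) can make the alternating alias smaller than the signal. [cite: DuminilCopinSmirnov2012Lattice, Proposition 8.6] -/
theorem conjStagger_barrier : ∀ (F : Site 2 × Site 2 → ℂ), (∀ p : Site 2 × Fin 2, HalfCRRelationAt Complex.I F p) → ∀ c : ℂ, (∀ p : Site 2 × Fin 2, HalfCRRelationAt Complex.I (F + c • conjStag F) p) ∧ ∀ v : Site 2, H2 (F + c • conjStag F) v = H2 F v + c * conj (H0 F v) :=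
  fun F hF c => ⟨halfCR_add_conjStag F hF c, fun v => H2_add_conjStag F c v⟩

end Summit.CriticalPhenomena.CardyFormulaZ2.Cruxes.EdgeCoherence.ConjStagger

end
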